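import Summits.ResolutionOfSingularities.ResolutionOfSingularities.Theorems.WeightedInvariantELadderOneStageInv
import Summits.ResolutionOfSingularities.ResolutionOfSingularities.Theorems.WeightedInvariantHypersurfaceCentreAssemblyDefs
import Summits.ResolutionOfSingularities.ResolutionOfSingularities.Theorems.WeightedInvariantHypersurfaceLocalGameEFT4SDimLEDoorGraded
import Summits.ResolutionOfSingularities.ResolutionOfSingularities.Theorems.WeightedInvariantHypersurfaceAdmissibleSequencesDim
import HarnessLib

/-!
# `WeightedInvariant` door `HypersurfaceCentreConstruction` (stmt-ResolutionOfSingularities-19897), E-LADDER rung `e = 2`: THE STAGE OBJECTS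
# and the three split targets of `stub_e2_consumer` (skeleton v3.9 → v3.10)

[OURS · L1 W4.3 · DOOR stmt-ResolutionOfSingularities-19897 · E2 tier; registrar res-L1-w43-plan-1's SPEC rev 2
(`L/res-L1-w43-plan-1/ELadderTwo_sketch.lean` sha16 b66de0810ad73990, ORDER (o47) deliverable (2)) landed near-verbatim by res-type-056
under ORDER (o55).  Candidate DEFINITIONS only; nothing is asserted; AI planning weaker than expert review; NOT a statement of Hironaka 2017
or of any manuscript under adjudication.]

Rung `e = 2` is rung `e = 1` (`ELadderOne.Stage`, `e1_assembly_unconditional`) ONE DIMENSION UP, reading the local game's letter `ι` at the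
ORBIT-GENERIC non-regular points of the stage (homogeneous primes with graded-simple quotient on the unit charts, ambient stalk of dimension
`≤ 3`) — IOTA3-DESIGN §9.10–§9.12, RULING gen 11 #7/#8 of the chain w43.

* `Stage.InvDim₂ S` — (I0)₂ `dim X = j + 2`;
* `Stage.IsOrbitGeneric S η` — the (I2w) text of rung 1 as a predicate of a point;
* `Stage.genSing₂ S` — orbit-generic points of `singImage` with ambient stalk of dimension `≤ 3`;
* `Stage.mu₂ ι S` — the maximum of `ι` over `genSing₂` (an ordinal supremum); `Stage.maxLocus₂ ι S`; `iotaAt_le_mu₂`,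
  `maxLocus₂_subset_singImage`, `maxLocus₂_subset_genSing₂`, `mem_maxLocus₂_iff`;
* `Stage.IsCanonicalCentre₂ ι J S R` — `R` is the canonical e = 2 centre: support = closure of the maximum locus, stalk filtration
  `J(𝒪_{Y,η}, f_η)` at the points of the maximum locus, trivial off the support (no saturation axiom, rev 2); `.support_subset`;
* the three SPLIT TARGETS of `stub_e2_consumer` as `Prop`s (`E2Base p`, `E2Centre p ι J`, `E2InvSucc p ι J`) and the shape of the assembly
  they feed (`E2AssemblyShape`; the assembly itself is `ELadder.ladder_assembly`, ORDER (o54)).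
-/

noncomputable section

set_option linter.dupNamespace false

open CategoryTheory AlgebraicGeometry TopologicalSpace IsLocalRing
open Literature.AlgebraicGeometry.Resolution
open Summit.ResolutionOfSingularities.ResolutionOfSingularities.Theorems
open Summit.ResolutionOfSingularities.ResolutionOfSingularities.Cruxes.HypersurfaceCentreConstruction.LocalEngine

namespace Summit.ResolutionOfSingularities.ResolutionOfSingularities.Theorems.ELadderOne.Stage

variable {k : Type} [Field k]

/-- (I0)₂ the dimension datum of rung 2: `dim X = j + 2`. [OURS · candidate] [folklore] -/
def InvDim₂ (S : Stage k) : Prop :=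
  topologicalKrullDim S.X = ((S.j + 2 : ℕ) : WithBot ℕ∞)

/-- ORBIT-GENERIC point: on every UNIT chart through `η`, the prime of `η` is homogeneous with graded-simple quotient
(the (I2w) text of rung 1, as a predicate of the point). [OURS · candidate] [folklore] -/
def IsOrbitGeneric (S : Stage k) (η : S.Y) : Prop :=
  ∀ (a : S.atlas.ι), S.IsUnitChart a → ∀ (hη : η ∈ (S.atlas.W a : S.Y.Opens)),
    letI := S.atlas.gradedRing a
    (((S.atlas.W a).2.primeIdealOf ⟨η, hη⟩).asIdeal).IsHomogeneous (S.atlas.piece a) ∧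
    ∀ (d : Fin S.j → ℤ) (x : Γ(S.Y, S.atlas.W a)), x ∈ S.atlas.piece a d →
      x ∉ ((S.atlas.W a).2.primeIdealOf ⟨η, hη⟩).asIdeal →
        IsUnit (Ideal.Quotient.mk ((S.atlas.W a).2.primeIdealOf ⟨η, hη⟩).asIdeal x)

/-- The orbit-generic non-regular points READ by rung 2: in `singImage`, orbit-generic, ambient stalk of dimension `≤ 3`
(the exceptional orbits — stalk dimension `≥ 4` — are never read: RULING #8). [OURS · candidate] [folklore] -/
def genSing₂ (S : Stage k) : Set S.Y :=
  {η | η ∈ singImage S.i.ker ∧ S.IsOrbitGeneric η ∧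
    ringKrullDim (S.Y.presheaf.stalk η) ≤ ((3 : ℕ) : WithBot ℕ∞)}

variable (ι : (R : Type) → [CommRing R] → R → Ordinal.{0}) (J : (R : Type) → [CommRing R] → R → ℕ → Ideal R)

/-- The termination measure of rung 2: the largest value of `ι(𝒪_{Y,η}, f_η)` over `genSing₂` (ordinal supremum;
`iotaAt` of `…HypersurfaceCentreAssemblyDefs`). [OURS · candidate] [folklore] -/
def mu₂ (S : Stage k) : Ordinal.{0} :=
  ⨆ η : {η : S.Y // η ∈ S.genSing₂}, iotaAt ι S.i.ker (η : S.Y)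

/-- The maximum locus of rung 2 (a set of orbit-generic points). [OURS · candidate] [folklore] -/
def maxLocus₂ (S : Stage k) : Set S.Y :=
  {η | η ∈ S.genSing₂ ∧ iotaAt ι S.i.ker η = S.mu₂ ι}

/-- `ι_η ≤ mu₂` on `genSing₂`. [OURS] [folklore] -/
theorem iotaAt_le_mu₂ (S : Stage k) {η : S.Y} (hη : η ∈ S.genSing₂) : iotaAt ι S.i.ker η ≤ S.mu₂ ι :=
  Ordinal.le_iSup (fun z : {η : S.Y // η ∈ S.genSing₂} => iotaAt ι S.i.ker (z : S.Y)) ⟨η, hη⟩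

/-- The maximum locus lies in `singImage`. [OURS] [folklore] -/
theorem maxLocus₂_subset_singImage (S : Stage k) : S.maxLocus₂ ι ⊆ singImage S.i.ker :=
  fun _ h => h.1.1

/-- The maximum locus lies in `genSing₂`. [OURS] [folklore] -/
theorem maxLocus₂_subset_genSing₂ (S : Stage k) : S.maxLocus₂ ι ⊆ S.genSing₂ :=
  fun _ h => h.1

/-- Membership in the maximum locus, unfolded. [OURS] [folklore] -/
theorem mem_maxLocus₂_iff (S : Stage k) (η : S.Y) : η ∈ S.maxLocus₂ ι ↔ η ∈ S.genSing₂ ∧ iotaAt ι S.i.ker η = S.mu₂ ι :=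
  Iff.rfl

/-- **The canonical centre of rung 2.** `R` is supported on the closure of the maximum locus; at every point of the maximum
locus its stalk filtration is the canonical centre filtration `J(𝒪_{Y,η}, f_η)` of the local game; off the support every
piece is the unit ideal.  (Field-for-field the door's `IsCanonicalCentre` with `maxLocus₂` for `maxLocus`; NO saturation axiom —
rev 2: the ladder consumes only the stalks at maximum-locus points, over which every orbit-generic successor lies, and
admissibility; uniqueness of `R` is not needed.) [OURS · candidate] [folklore] -/
structure IsCanonicalCentre₂ (S : Stage k) (R : ReesAlgebraData S.Y) : Prop where
  /-- support = closure of the maximum locus -/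
  support_eq : R.support = closure (S.maxLocus₂ ι)
  /-- stalks on the maximum locus -/
  stalkIdeal_eq : ∀ η ∈ S.maxLocus₂ ι, ∀ n, stalkIdeal (R.piece n) η = J (S.Y.presheaf.stalk η) (localGenerator S.i.ker η) n
  /-- off the support every piece is trivial -/
  stalkIdeal_eq_top : ∀ y ∉ closure (S.maxLocus₂ ι), ∀ n, stalkIdeal (R.piece n) y = ⊤

/-- The support of a canonical e = 2 centre lies in (the closure of) the non-regular image. [OURS] [folklore] -/
theorem IsCanonicalCentre₂.support_subset (S : Stage k) {R : ReesAlgebraData S.Y} (hR : S.IsCanonicalCentre₂ ι J R) :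
    R.support ⊆ closure (singImage S.i.ker) := by
  rw [hR.support_eq]
  exact closure_mono (S.maxLocus₂_subset_singImage ι)

end Summit.ResolutionOfSingularities.ResolutionOfSingularities.Theorems.ELadderOne.Stage

/-! ## The three split targets of `stub_e2_consumer` (skeleton v3.10 shape) -/

namespace Summit.ResolutionOfSingularities.ResolutionOfSingularities.Cruxes.HypersurfaceCentreConstruction.LocalEngine

open Summit.ResolutionOfSingularities.ResolutionOfSingularities.Theorems.ELadderOne

/-- E2 BASE: every integral hypersurface pair of dimension 2 is the pair of a start stage (`j = 0`) satisfying (I0)₂.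
(Port of `ELadderOne.stub_e1_base`: the start stage is dimension-free; only the invariant changes.) [OURS · candidate] [folklore] -/
def E2Base (p : ℕ) : Prop :=
  ∀ ⦃k : Type⦄ [Field k] [CharP k p] [PerfectField k] (P : HypersurfacePair k),
    topologicalKrullDim P.X.subscheme = ((2 : ℕ) : WithBot ℕ∞) →
    ∃ S : Stage k, S.InvDim₂ ∧ S.j = 0 ∧ S.toPair = P

/-- E2 CENTRE: under the graded rung for the pair `(ι, J)`, a non-regular stage satisfying (I0)₂ carries an ADMISSIBLE canonical
e = 2 centre off the generic point of `X` (LINE lemmas [S1]/[S3]–[S6] read at orbit-generic points: (c8-gr)≤3 for the closed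
maximum locus and finitely many values, (open″)≤3 + [S5] homogeneity + (c11) for regularity/homogeneity of the glued centre).
[OURS · candidate] [folklore] -/
def E2Centre (p : ℕ) (ι : (R : Type) → [CommRing R] → R → Ordinal.{0})
    (J : (R : Type) → [CommRing R] → R → ℕ → Ideal R) : Prop :=
  PRungGrLE 3 p ι J →
  ∀ ⦃k : Type⦄ [Field k] [CharP k p] [PerfectField k] (S : Stage k), S.InvDim₂ → ¬ Scheme.IsRegular S.X →
    ∃ R : ReesAlgebraData S.Y, IsAdmissibleCentre S.f S.i.ker R ∧ S.i (genericPoint S.X) ∉ R.support ∧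
      S.IsCanonicalCentre₂ ι J R

/-- E2 SUCCESSOR: blowing up the canonical e = 2 centre keeps (I0)₂ and DROPS `mu₂` ((c9′)≤3 at the orbit-generic points over
the centre, (c6)/(c-u) off it; binders = those of `ELadderOne.stub_e1_inv_succ` with the e = 2 currency). [OURS · candidate] [folklore] -/
def E2InvSucc (p : ℕ) (ι : (R : Type) → [CommRing R] → R → Ordinal.{0})
    (J : (R : Type) → [CommRing R] → R → ℕ → Ideal R) : Prop :=
  PRungGrLE 3 p ι J →
  ∀ ⦃k : Type⦄ [Field k] [CharP k p] [PerfectField k] (S : Stage k), S.InvDim₂ → ¬ Scheme.IsRegular S.X →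
    ∀ (R : ReesAlgebraData S.Y), IsAdmissibleCentre S.f S.i.ker R → S.i (genericPoint S.X) ∉ R.support →
      S.IsCanonicalCentre₂ ι J R →
    ∀ (R' : ReesFiltration S.Y), R'.ideal = R.piece →
    ∀ [Smooth (R'.πPlus ≫ S.f)] [IsSeparated (R'.πPlus ≫ S.f)] [QuasiCompact (R'.πPlus ≫ S.f)]
      [IsIntegral (R'.strictTransformPlus S.i.ker).subscheme]
      (hlp' : IsLocallyPrincipal (R'.strictTransformPlus S.i.ker).subschemeι.ker)
      (V' : Scheme.{0}) (ρ : V' ⟶ S.V) [IsIntegral V'] [IsProper ρ]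
      (q' : (R'.strictTransformPlus S.i.ker).subscheme ⟶ V')
      (hq' : q' ≫ ρ ≫ S.g = (R'.strictTransformPlus S.i.ker).subschemeι ≫ R'.πPlus ≫ S.f)
      (𝒜' : GradedAtlas (S.j + 1) (R'.πPlus ≫ S.f) (R'.strictTransformPlus S.i.ker).subschemeι q'),
      (⟨R'.plus, R'.πPlus ≫ S.f, (R'.strictTransformPlus S.i.ker).subscheme,
          (R'.strictTransformPlus S.i.ker).subschemeι, hlp', V', q', ρ ≫ S.g, hq', S.j + 1, 𝒜'⟩ : Stage k).InvDim₂ ∧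
        (⟨R'.plus, R'.πPlus ≫ S.f, (R'.strictTransformPlus S.i.ker).subscheme,
          (R'.strictTransformPlus S.i.ker).subschemeι, hlp', V', q', ρ ≫ S.g, hq', S.j + 1, 𝒜'⟩ : Stage k).mu₂ ι <
          S.mu₂ ι

/-- SHAPE OF THE v3.10 ASSEMBLY (statement only; the proof is ORDER (o54)'s `ELadder.ladder_assembly` with `Inv := InvDim₂`,
`μ := mu₂ ι`, `Good S R := IsCanonicalCentre₂ ι J S R`, plus `E2Base` for the start and `KeyRungGrLE 3 p` to pick the pair).
[OURS · candidate] [folklore] -/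
def E2AssemblyShape (p : ℕ) : Prop :=
  (∀ ι J, E2Centre p ι J) → (∀ ι J, E2InvSucc p ι J) → E2Base p →
    KeyRungGrLE 3 p → AdmissiblyResolvableDim p 2

end Summit.ResolutionOfSingularities.ResolutionOfSingularities.Cruxes.HypersurfaceCentreConstruction.LocalEngine

end
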